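import Summits.ABC.StewartYu.PadicTwistExists
import Mathlib.NumberTheory.Padics.Complex
import HarnessLib

/-!
# Cell abc-stewartyu, WP-Y provider B (0): existence of the twisting data at ANY odd prime —
# Teichmüller twists by powers of ONE primitive `(p−1)`-th root of unity, and its square root in `ℂ_p`

`Summits/ABC/StewartYu/PadicTwistExistsAnyOrder.lean` — cell `abc-stewartyu` (HOME
`run/shared/lean/pub/abc-stewartyu/`, seat p3; cruxes `W80OneModFour` stmt-ABC-19487 (p ≡ 1 mod 4) and
`W80ThreeModFour` stmt-ABC-19485; design memo HOME/p3/memo-05 §5 (B6)). p2's `PadicTwistExists.lean`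
gives the twist at `p ≡ 3 (mod 4)` by roots of unity of the ODD order `(p−1)/2` (up to a sign). The
`p ≡ 1 (mod 4)` engine (provider B, the ± class chain) twists by powers `ζ^{rⱼ}` of one primitive
`(p−1)`-th root of unity `ζ ∈ ℚ_p` and reads the half points in `ℂ_p` through a square root `ξ` of `ζ`
(`ξ^{(p−1)/2} =: ι`, `ι² = ζ^{(p−1)/2} = −1`). This file supplies exactly that data, for every odd prime:
`twist_exists_family_anyOrder` (the exponents `rⱼ` with `‖aⱼ ζ^{rⱼ} − 1‖_p ≤ p⁻¹`, lit's Teichmüller lemma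
`padicInt_exists_norm_mul_pow_sub_one_lt`) and `exists_sqrt_root_padicComplex` (`ξ`, `ι` in `ℂ_p` with
`‖ξ‖ = 1`, by algebraic closedness). [folklore] algebra; no named fact.
-/

noncomputable section

open Literature.NumberTheory.LocalFields
open Literature.NumberTheory.EllipticCurves.Kato2004 (padicInt_exists_isPrimitiveRoot_sub_one)

namespace Summit.ABC.StewartYu

namespace TwistExistsAnyOrder

variable {p : ℕ} [Fact p.Prime]

/-- **A primitive `(p−1)`-th root of unity in `ℚ_p`** (`p ≥ 3`) with `ζ^{(p−1)/2} = −1` and `‖ζ‖ = 1`.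
[folklore] -/
theorem exists_primitiveRoot (hp3 : 3 ≤ p) :
    ∃ ζ : ℚ_[p], IsPrimitiveRoot ζ (p - 1) ∧ ζ ^ ((p - 1) / 2) = -1 ∧ ‖ζ‖ = 1 := by
  obtain ⟨ζ, hζ⟩ := padicInt_exists_isPrimitiveRoot_sub_one (p := p)
  have hinj : Function.Injective (PadicInt.Coe.ringHom (p := p)) := fun a b h => PadicInt.ext h
  refine ⟨(ζ : ℚ_[p]), ?_, ?_, ?_⟩
  · have := hζ.map_of_injective hinj
    exact this
  · have h := congrArg ((↑) : ℤ_[p] → ℚ_[p]) (TwistSetup.pow_half_eq_neg_one hp3 hζ)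
    push_cast at h
    exact h
  · have h1 : ((ζ : ℚ_[p])) ^ (p - 1) = 1 := by
      have := congrArg ((↑) : ℤ_[p] → ℚ_[p]) hζ.pow_eq_one
      push_cast at this; exact this
    have hn := congrArg (‖·‖) h1
    simp only [norm_pow, norm_one] at hn
    exact (pow_eq_one_iff_of_nonneg (norm_nonneg _) (by omega)).mp hn

/-- **Teichmüller twist of a family by powers of one primitive root** (any odd prime `p`): for rational
`p`-adic units `aⱼ` there are exponents `rⱼ < p − 1` with `‖aⱼ · ζ^{rⱼ} − 1‖_p ≤ p⁻¹`. [folklore] -/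
theorem twist_exists_family_anyOrder {ζ : ℚ_[p]} (hζ1 : ‖ζ‖ = 1)
    (hζ : IsPrimitiveRoot ζ (p - 1)) {n : ℕ} (a : Fin n → ℚ) (ha : ∀ j, a j ≠ 0)
    (hva : ∀ j, padicValRat p (a j) = 0) :
    ∃ r : Fin n → ℕ, ∀ j, r j < p - 1 ∧ ‖((a j : ℚ) : ℚ_[p]) * ζ ^ r j - 1‖ ≤ (p : ℝ)⁻¹ := by
  -- `ζ` as an element of `ℤ_p`, primitive there
  set Z : ℤ_[p] := ⟨ζ, hζ1.le⟩ with hZ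
  have hinj : Function.Injective (PadicInt.Coe.ringHom (p := p)) := fun a b h => PadicInt.ext h
  have hZprim : IsPrimitiveRoot Z (p - 1) := by
    refine (IsPrimitiveRoot.map_iff_of_injective hinj).mp ?_
    show IsPrimitiveRoot ((Z : ℚ_[p])) (p - 1)
    exact hζ
  have hone : ∀ j, ∃ rj : ℕ, rj < p - 1 ∧ ‖((a j : ℚ) : ℚ_[p]) * ζ ^ rj - 1‖ ≤ (p : ℝ)⁻¹ := by
    intro j
    have hna : ‖((a j : ℚ) : ℚ_[p])‖ = 1 := by
      rw [Padic.norm_eq_zpow_neg_valuation (by exact_mod_cast ha j), Padic.valuation_ratCast, hva j]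
      simp
    set A : ℤ_[p] := ⟨((a j : ℚ) : ℚ_[p]), hna.le⟩ with hA
    have hAn : ‖A‖ = 1 := hna
    obtain ⟨rj, hrj, hlt⟩ := padicInt_exists_norm_mul_pow_sub_one_lt hZprim hAn
    refine ⟨rj, hrj, TwistSetup.norm_sub_one_le_inv_of_lt ?_⟩
    have : ((A * Z ^ rj - 1 : ℤ_[p]) : ℚ_[p]) = ((a j : ℚ) : ℚ_[p]) * ζ ^ rj - 1 := by
      push_cast; rfl
    rw [← this, ← PadicInt.norm_def] at *
    exact hlt
  choose r hr using hone
  exact ⟨r, hr⟩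

/-- **The square root of `ζ` in `ℂ_p`**: for `ζ ∈ ℚ_p` with `‖ζ‖ = 1` and `ζ^M = −1` there are
`ξ, ι ∈ ℂ_p` with `ξ² = ζ`, `ξ^M = ι`, `ι² = −1`, `‖ξ‖ = 1` (algebraic closedness of `ℂ_p`; the norm
extends that of `ℚ_p`). [folklore] -/
theorem exists_sqrt_root_padicComplex {ζ : ℚ_[p]} (hζ1 : ‖ζ‖ = 1) {M : ℕ} (hζM : ζ ^ M = -1) :
    ∃ ξ ιC : ℂ_[p], ξ ^ 2 = algebraMap ℚ_[p] ℂ_[p] ζ ∧ ξ ^ M = ιC ∧ ιC ^ 2 = -1 ∧ ‖ξ‖ = 1 := by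
  obtain ⟨ξ, hξ⟩ := IsAlgClosed.exists_pow_nat_eq (algebraMap ℚ_[p] ℂ_[p] ζ) (by norm_num : 0 < 2)
  refine ⟨ξ, ξ ^ M, hξ, rfl, ?_, ?_⟩
  · rw [← pow_mul, mul_comm, pow_mul, hξ, ← map_pow, hζM, map_neg, map_one]
  · have hn : ‖ξ‖ ^ 2 = 1 := by
      rw [← norm_pow, hξ, show algebraMap ℚ_[p] ℂ_[p] ζ = ((ζ : ℚ_[p]) : ℂ_[p]) from rfl,
        PadicComplex.norm_extends', hζ1]
    exact (pow_eq_one_iff_of_nonneg (norm_nonneg _) two_ne_zero).mp hn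

end TwistExistsAnyOrder

end Summit.ABC.StewartYu

end
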